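import Literature.MathematicalPhysics.QuantumFieldTheory.Balaban1983to89.B5Hk163Torus
import Literature.MathematicalPhysics.QuantumFieldTheory.Balaban1983to89.B5Blocks16
import Literature.MathematicalPhysics.QuantumFieldTheory.Balaban1983to89.Beta.RemainderDecay190SupNormLimit

/-!
# [Balaban1987RG1] (1.21) p. 264 ⟵ [Balaban1984PropagatorsI] p. 36: NODE E's field `hconv` FOR BAŁABAN'S FLAT `H_k` on the
two-grid carrier — the torus kernel of `H_k` converges ENTRYWISE to its infinite-lattice kernel as the volume grows
(`Beta.RemainderDecay190TwoGridHkLimit`)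

statement-level skeleton of published theorems with citation tags; proofs where landed; nothing here is a claim
about the Yang–Mills mass gap.

HONEST FRAMING (cell rule, page 1 of everything).  Discharging `BetaPertH` makes Bałaban's UV stability UNCONDITIONAL —
a real constructive-QFT result; it is NOT the continuum limit and NOT the Clay problem.  This module discharges NOTHING
of `BetaPertH`.  Bookkeeping for the k-uniform remainder chain of row (D4) (`RemainderConst` ⇐ ONE `ChainTFac190`
instance, `Beta.RemainderDecay190`).  Unit `b2b-balaban-beta-an4` gen 102 (BINDER row D4 OWNER; cell pub-balaban).
Imports `B5Hk163Torus` (the typed flat `H_k` and its kernel dictionary), `B5Blocks16` (`blockOf_bpt`) and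
`Beta.RemainderDecay190SupNormLimit` (the socket `Data190`, the torus leaf-list carriers, `tcubeOf_proj_mem_tproj`) ONLY;
nothing edited.

WHAT.  The leaf lists of row (D4) consume the (4.35) test vectors `𝒟.hn n X̄ x` of a (190)-socket `𝒟 : Data190` through
NODE E's field `hconv` of `RemainderDecay190.PolLeavesTFac190` ([I] (1.21) p. 264: *"T^{(j+1)} ↗ ℤ^d … This limit exists
by the localized representation (1.7)"*): `r n Y (𝒟.hn n (tproj Y) [x]) → t Y x` for restriction maps
`r n Y : Wn n →L[ℂ] V Y`, as the number `N n` of M-cubes per direction of the torus tends to infinity.  Generation 101 of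
this lineage INHABITED NODE D's socket on the TWO-GRID carrier (`Beta.RemainderDecay190TwoGrid`: B-data = coarse 1-forms
`T₁ × Fin D → ℂ`, configurations = fine 1-forms `T_η × Fin D → ℂ`) by Bałaban's own flat linearized minimizer
`H_k = B5Hk163Torus.HkOp nm (fun _ => N n·M)` of [B5] (1.59)–(1.63), hypothesis-free (`Beta.RemainderDecay190TwoGridHk`,
computation rule `𝒟.hn n X̄ y = (p ↦ cube(blockOf p.1) ∈ X̄ ? (H_k δ_{(y,μ₀)})(p) : 0)`).  THIS FILE supplies NODE E's field
for THAT inhabitant, again hypothesis-free, from the tree's Fourier bookkeeping ([B5] p. 36 l. 20–23 *"relating G on the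
torus to G on the whole lattice in the usual way"*: the torus kernel is the periodisation of the lattice kernel,
`B4TorusKernel.MultiPeriod.torusKernel_descend_eq`):
* §1 **`tendsto_tsum_translate`** — THE ENTRYWISE VOLUME LIMIT OF A PERIODISATION (ℂ-valued, sup-norm decay, unequal
  periods): if `‖K(y)‖ ≤ M e^{−κ|y|_∞}` on `ℤ^{d+1}` with `κ > 0` and every period `P_n(i) → ∞`, then
  `Σ_{m ∈ ℤ^{d+1}} K(x + P_n m) → K(x)` — Tannery's theorem (`tendsto_tsum_of_dominated_convergence`) with the summable
  majorant `A·Π_i r^{|m_i|}` of `B4TorusKernel.MultiPeriod.norm_translate_le` (valid once `2|x_i| ≤ P_n(i)`) and the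
  termwise limits `K(x + P_n m) → 0` (`m ≠ 0`: `|x + P_n m|_∞ ≥ P_n(i) − |x_i| → ∞`).
* §2 **`tendsto_torusKernel_descend`** (+ `_const`, equal periods) — for a strip-regular multiplier `G` the torus kernels
  converge to the lattice kernel: `torusKernel (descendC G) P_n x → latticeKernel G x`; **`tendsto_hker_bpt`** — THE KERNEL OF THE TYPED `H_k`
  CONVERGES: `H_k^{(P_n)}((nm·x̄′ + a, μ), (x̄, λ)) → latticeKernel (G163 nm μ λ a) (x′ − x)` for every mesh `nm`, fine
  offset `a`, directions `μ, λ` and lattice representatives `x′, x ∈ ℤ^{d+1}`, whenever all periods tend to infinity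
  (`B5Hk163Torus.hker_bpt` + `gker_toT_eq_torusKernel` + §1; the limit is the `(2π)^{−(d+1)}∫dp′` kernel of [B5] (1.63),
  `B4ContourShift.latticeKernel`, whose decay is `B5Hk163Decay.latticeKernel_G163_decay`).
* §3 **`hconv_twoGrid_HkOp_of_rule`** — NODE E's FIELD ON THE TWO-GRID CARRIER: for ANY (190)-socket `𝒟` over
  `Wn n := T_η(n) × Fin D → ℂ` with generation 101's computation rule (`hrule`), any window of finitely many FINE LATTICE
  BONDS `(nm·x′_i + a_i, μ_i)` with the coarse points `x′_i` inside the cubes of `Y` (`he`), and `N n → ∞`: the window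
  read-out of the test vector converges,
  `(𝒟.hn n (tproj Y) [x] (nm·[x′_i] + a_i, μ_i))_i → (latticeKernel (G163 nm μ_i μ₀ a_i) (x′_i − x))_i` — literally the
  field `hconv` with `V Y := ι Y → ℂ`, `r n Y :=` the product of the coordinate projections at the window bonds (a
  continuous linear map, displayed in the statement), `t Y x :=` the window column of the infinite-lattice kernel of `H_k`.
AFTER THIS FILE the flat `H_k` inhabits NODE D (generation 101) AND NODE E (here) of row (D4) with no letter carried; what
it does NOT inhabit is unchanged: the (4.35) representation `hrepr` (NODE B: that `H_k` IS `(δ/δB)𝓗_k(□₀,0)` at zero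
background), anything in a background field, (189), (181), the multi-level geometry.  Row D4 class UNCHANGED (instance
0∕1; D4 DISCHARGE NO DATE).  No `def`, no named fact, no `sorry`, standard axioms.  NOT B12 Thm 2, NOT BetaPertH, NOT
the continuum limit, NOT Clay.
HONEST DEPENDENCY: continuum YM on T⁴ ⇐ BetaPertH ∧ nine spine estimates (0/9 proved); BetaPertH ⇐ (D1) ∧ (D4) ∧
CAP+tail; G-an2-4 gates asym, D1 and NE2/3/4.

Sources: [I] = T. Bałaban, *Renormalization group approach to lattice gauge field theories. I*, Commun. Math. Phys.
**109** (1987) 249–301 [Balaban1987RG1], (1.21) p. 264, (4.35) p. 290, (5.10) p. 293; [B5] = T. Bałaban, *Propagators and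
renormalization transformations for lattice gauge theories. I*, Commun. Math. Phys. **95** (1984) 17–40
[Balaban1984PropagatorsI], (1.63) p. 28, p. 36 l. 20–23, (1.126) p. 38.  Locations only; the mathematics is [folklore]
Fourier bookkeeping on finite tori and Tannery's theorem, over the tree's `B4TorusKernel` ∕ `B5Hk163Torus` BY NAME.
-/

namespace Literature.MathematicalPhysics.QuantumFieldTheory.Balaban1983to89.Beta.RemainderDecay190TwoGridHkLimit

open Literature.MathematicalPhysics.QuantumFieldTheory.Balaban1983to89
open Literature.MathematicalPhysics.QuantumFieldTheory.Balaban1983to89.B4ContourShift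
  (StripRegular latticeKernel supNorm latticeKernel_decay abs_le_supNorm)
open Literature.MathematicalPhysics.QuantumFieldTheory.Balaban1983to89.B4TorusKernel
  (descendC summable_prod_pi summable_geometric_int)
open Literature.MathematicalPhysics.QuantumFieldTheory.Balaban1983to89.B4TorusKernel.MultiPeriod
  (translate translate_apply torusKernel_descend_eq norm_translate_le)
open Literature.MathematicalPhysics.QuantumFieldTheory.Balaban1983to89.B5Prop11Plancherel (Tor fine)
open Literature.MathematicalPhysics.QuantumFieldTheory.Balaban1983to89.B5Block118 (bpt)
open Literature.MathematicalPhysics.QuantumFieldTheory.Balaban1983to89.B5Hk163Torus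
  (HkOp hker hker_bpt gker_toT_eq_torusKernel)
open Literature.MathematicalPhysics.QuantumFieldTheory.Balaban1983to89.B5Hk163Decay (G163 stripRegular_G163)
open Literature.MathematicalPhysics.QuantumFieldTheory.Balaban1983to89.B5Hk163Strip (kappa163 kappa163_pos)
open Literature.MathematicalPhysics.QuantumFieldTheory.Balaban1983to89.B5Kernel166Decay (toT_sub)
open Literature.MathematicalPhysics.QuantumFieldTheory.Balaban1983to89.B6LowerBound2153Torus (toT)
open Literature.MathematicalPhysics.QuantumFieldTheory.Balaban1983to89.B13ScaleTransfer (Pt)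
open Literature.MathematicalPhysics.QuantumFieldTheory.Balaban1983to89.TreeLengthTorus (TPt TDom proj)
open Literature.MathematicalPhysics.QuantumFieldTheory.Balaban1983to89.B12Decay510Lattice (cubeOf)
open Literature.MathematicalPhysics.QuantumFieldTheory.Balaban1983to89.B12Decay510Torus (tcubeOf)
open Literature.MathematicalPhysics.QuantumFieldTheory.Balaban1983to89.Beta.RemainderLimitTorus (LDom tproj)
open Literature.MathematicalPhysics.QuantumFieldTheory.Balaban1983to89.Beta.RemainderDecay190 (Data190 Consts190)
open Literature.MathematicalPhysics.QuantumFieldTheory.Balaban1983to89.Beta.RemainderDecay190SupNormLimit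
  (tcubeOf_proj_mem_tproj)
open Filter
open scoped Topology Matrix

noncomputable section

variable {d : ℕ}

/-! ## 1. The entrywise volume limit of a periodisation (ℂ-valued kernels with sup-norm decay, unequal periods) -/

section Periodisation

/-- (private helper) The constant of a sup-norm decay bound `‖K y‖ ≤ M e^{−κ|y|_∞}` is non-negative (read at `y = 0`).
[folklore] -/
private theorem const_nonneg_of_decay (K : (Fin (d + 1) → ℤ) → ℂ) {κ M : ℝ}
    (hK : ∀ y, ‖K y‖ ≤ M * Real.exp (-(κ * supNorm y))) : 0 ≤ M := by
  have h := hK 0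
  nlinarith [norm_nonneg (K 0), Real.exp_pos (-(κ * supNorm (0 : Fin (d + 1) → ℤ)))]

/-- (private helper) **A non-zero image is far**: if `m_i ≠ 0` then `|x + Pm|_∞ ≥ P_i − |x_i|` (the `i`-th coordinate
alone: `|x_i + P_i m_i| ≥ P_i|m_i| − |x_i| ≥ P_i − |x_i|`). [folklore] -/
private theorem sub_abs_le_supNorm_translate (P : Fin (d + 1) → ℕ) (x m : Fin (d + 1) → ℤ) (i : Fin (d + 1))
    (hi : m i ≠ 0) : (P i : ℝ) - |(x i : ℝ)| ≤ supNorm (translate P x m) := by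
  have h1 : ((|translate P x m i| : ℤ) : ℝ) ≤ supNorm (translate P x m) := abs_le_supNorm _ i
  have hm : (1 : ℝ) ≤ |(m i : ℝ)| := by exact_mod_cast Int.one_le_abs hi
  have hP : (0 : ℝ) ≤ (P i : ℝ) := Nat.cast_nonneg _
  have h2 : (P i : ℝ) ≤ |(P i : ℝ) * (m i : ℝ)| := by
    rw [abs_mul, abs_of_nonneg hP]
    nlinarith
  have h3 : |(P i : ℝ) * (m i : ℝ)| - |(x i : ℝ)| ≤ |(x i : ℝ) + (P i : ℝ) * (m i : ℝ)| := by
    have h := abs_sub_abs_le_abs_sub ((P i : ℝ) * (m i : ℝ)) (-(x i : ℝ))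
    rw [abs_neg, sub_neg_eq_add, add_comm] at h
    exact h
  have h4 : ((|translate P x m i| : ℤ) : ℝ) = |(x i : ℝ) + (P i : ℝ) * (m i : ℝ)| := by
    rw [translate_apply]; push_cast; rfl
  linarith

/-- **THE ENTRYWISE VOLUME LIMIT OF A PERIODISATION.**  Let `K : ℤ^{d+1} → ℂ` with `‖K(y)‖ ≤ M e^{−κ|y|_∞}`, `κ > 0`,
and let `P_n` be period vectors (all `P_n(i) ≥ 1`) with `P_n(i) → ∞` for every `i`.  Then for every `x ∈ ℤ^{d+1}` the
periodisations converge to the kernel: `Σ_{m ∈ ℤ^{d+1}} K(x + P_n m) → K(x)`.  Tannery's theorem: the summable majorant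
`M e^{κ′(d+1)} e^{−κ′Σ|x_i|}·Π_i (e^{−κ′})^{|m_i|}`, `κ′ = κ∕(d+1)`, of `B4TorusKernel.MultiPeriod.norm_translate_le` holds
as soon as the torus is centred around `x` (`2|x_i| ≤ P_n(i)`, eventually); the term `m = 0` is `K(x)`, every other
term tends to `0` by `sub_abs_le_supNorm_translate`.  ([B5] p. 36 l. 20–23: the torus kernel is related to the
whole-lattice kernel *"in the usual way"*; [I] (5.10) p. 293 is the printed use of such limits.)
[cite: Balaban1984PropagatorsI, p.36; Balaban1987RG1, (1.21) p.264, (5.10) p.293] [folklore] -/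
theorem tendsto_tsum_translate (K : (Fin (d + 1) → ℤ) → ℂ) {κ M : ℝ} (hκ : 0 < κ)
    (hK : ∀ y, ‖K y‖ ≤ M * Real.exp (-(κ * supNorm y))) {P : ℕ → Fin (d + 1) → ℕ}
    (hP1 : ∀ n i, 1 ≤ P n i) (hP : ∀ i, Tendsto (fun n => P n i) atTop atTop) (x : Fin (d + 1) → ℤ) :
    Tendsto (fun n => ∑' m : Fin (d + 1) → ℤ, K (translate (P n) x m)) atTop (𝓝 (K x)) := by
  have hM : 0 ≤ M := const_nonneg_of_decay K hK
  set κ' : ℝ := κ / (d + 1) with hκ'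
  have hκ'pos : 0 < κ' := div_pos hκ (by positivity)
  set r : ℝ := Real.exp (-κ') with hr
  have hr0 : 0 ≤ r := (Real.exp_pos _).le
  have hr1 : r < 1 := Real.exp_lt_one_iff.mpr (by linarith)
  set A : ℝ := M * (Real.exp κ' ^ (d + 1) * Real.exp (-(κ' * ∑ i, |((x i : ℤ) : ℝ)|))) with hA
  obtain ⟨hgs, -⟩ := summable_geometric_int hr0 hr1
  obtain ⟨hps, -⟩ := summable_prod_pi (k := d + 1) (fun _ j => r ^ j.natAbs)
    (fun _ j => pow_nonneg hr0 _) (fun _ => hgs)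
  have hgsum : ∑' m : Fin (d + 1) → ℤ, (if m = 0 then K x else 0) = K x := by simp
  rw [← hgsum]
  refine tendsto_tsum_of_dominated_convergence (f := fun n m => K (translate (P n) x m))
    (g := fun m : Fin (d + 1) → ℤ => if m = 0 then K x else 0)
    (bound := fun m : Fin (d + 1) → ℤ => A * ∏ i, r ^ (m i).natAbs) (hps.mul_left A) ?_ ?_
  · -- termwise limits
    intro m
    by_cases hm : m = 0
    · subst hm
      have e : ∀ n, translate (P n) x 0 = x := fun n => by
        funext i; rw [translate_apply, Pi.zero_apply, mul_zero, add_zero]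
      simp only [e, if_true]
      exact tendsto_const_nhds
    · simp only [if_neg hm]
      obtain ⟨i, hi⟩ : ∃ i, m i ≠ 0 := by
        by_contra h
        push Not at h
        exact hm (funext h)
      have hlim : Tendsto (fun n => M * Real.exp (-(κ * ((P n i : ℝ) - |(x i : ℝ)|)))) atTop (𝓝 0) := by
        have h1 : Tendsto (fun n => (P n i : ℝ)) atTop atTop := tendsto_natCast_atTop_atTop.comp (hP i)
        have h2 : Tendsto (fun n => (P n i : ℝ) - |(x i : ℝ)|) atTop atTop := by
          simpa only [sub_eq_add_neg] using tendsto_atTop_add_const_right atTop (-|(x i : ℝ)|) h1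
        have h3 : Tendsto (fun n => κ * ((P n i : ℝ) - |(x i : ℝ)|)) atTop atTop := h2.const_mul_atTop hκ
        have h4 := Real.tendsto_exp_atBot.comp (tendsto_neg_atTop_atBot.comp h3)
        simpa using h4.const_mul M
      refine squeeze_zero_norm (fun n => ?_) hlim
      refine (hK _).trans (mul_le_mul_of_nonneg_left (Real.exp_le_exp.mpr ?_) hM)
      have h := sub_abs_le_supNorm_translate (P n) x m i hi
      nlinarith
  · -- domination, once the torus is centred around `x`
    have hev : ∀ᶠ n in atTop, ∀ i, 2 * |x i| ≤ (P n i : ℤ) := by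
      refine eventually_all.2 fun i => ?_
      have h1 : Tendsto (fun n => (P n i : ℤ)) atTop atTop := tendsto_natCast_atTop_atTop.comp (hP i)
      exact h1.eventually (eventually_ge_atTop (2 * |x i|))
    refine hev.mono fun n hn m => ?_
    have h := norm_translate_le K hκ.le hK (hP1 n) x hn m
    rw [hA, hr, hκ']
    exact h

end Periodisation

/-! ## 2. The torus kernels of a strip-regular multiplier, and the kernel of `H_k`, converge to the lattice kernel -/

section Kernels

/-- **TORUS KERNEL → LATTICE KERNEL.**  For a strip-regular multiplier `G` (`B4ContourShift.StripRegular G κ M`, `κ > 0`)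
and period vectors `P_n ≥ 1` with every `P_n(i) → ∞`:
`(Π_i P_n(i))⁻¹ Σ_k G(2π rep(k∕P_n)) e^{2πi k·x∕P_n} → (2π)^{−(d+1)} ∫ G(p) e^{ip·x} dp`, i.e.
`torusKernel (descendC G) P_n x → latticeKernel G x` — the torus kernel is the periodised lattice kernel
(`B4TorusKernel.MultiPeriod.torusKernel_descend_eq`, [B5] p. 36 l. 20–23) and §1 applies with the decay
`B4ContourShift.latticeKernel_decay`. [cite: Balaban1984PropagatorsI, p.36, (1.126) p.38] [folklore] -/
theorem tendsto_torusKernel_descend {G : (Fin (d + 1) → ℂ) → ℂ} {κ M : ℝ} (h : StripRegular G κ M) (hκ : 0 < κ)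
    {P : ℕ → Fin (d + 1) → ℕ} (hP1 : ∀ n i, 1 ≤ P n i) (hP : ∀ i, Tendsto (fun n => P n i) atTop atTop)
    (x : Fin (d + 1) → ℤ) :
    Tendsto (fun n => B4TorusKernel.MultiPeriod.torusKernel (descendC G h hκ.le) (P n) x) atTop
      (𝓝 (latticeKernel G x)) := by
  refine (tendsto_tsum_translate (latticeKernel G) hκ (latticeKernel_decay h hκ.le) hP1 hP x).congr fun n => ?_
  exact (torusKernel_descend_eq h hκ (hP1 n) x).symm

/-- The equal-period form (`B4TorusKernel.torusKernel`, ONE period `T n → ∞` in every direction, the engine of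
`B5Kernel166Decay` ∕ `B4TorusGreen244`): `torusKernel (descendC G) (T n) x → latticeKernel G x`
(`B4TorusKernel.MultiPeriod.torusKernel_const` + `tendsto_torusKernel_descend`). [cite: Balaban1984PropagatorsI, p.36, (1.126) p.38] [folklore] -/
theorem tendsto_torusKernel_descend_const {G : (Fin (d + 1) → ℂ) → ℂ} {κ M : ℝ} (h : StripRegular G κ M)
    (hκ : 0 < κ) {T : ℕ → ℕ} (hT1 : ∀ n, 1 ≤ T n) (hT : Tendsto T atTop atTop) (x : Fin (d + 1) → ℤ) :
    Tendsto (fun n => B4TorusKernel.torusKernel (descendC G h hκ.le) (T n) x) atTop (𝓝 (latticeKernel G x)) := by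
  refine (tendsto_torusKernel_descend h hκ (P := fun n (_ : Fin (d + 1)) => T n) (fun n _ => hT1 n) (fun _ => hT)
    x).congr fun n => ?_
  exact B4TorusKernel.MultiPeriod.torusKernel_const _ (T n) x

/-- **THE KERNEL OF BAŁABAN'S FLAT `H_k` CONVERGES ENTRYWISE AS THE VOLUME GROWS.**  For every mesh `nm ≥ 1`,
directions `μ, λ`, fine offset `a`, lattice representatives `x′, x ∈ ℤ^{d+1}`, and tori `Π_i ℤ∕P_n(i)` with every
`P_n(i) → ∞`: the kernel of the typed torus operator `H_k = B5Hk163Torus.HkOp nm P_n` between the fine bond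
`(nm·x̄′ + a, μ)` and the coarse bond `(x̄, λ)` converges to the infinite-lattice kernel of the (1.63) multiplier,
`latticeKernel (G163 nm μ λ a) (x′ − x)` (`B5Hk163Torus.hker_bpt` + `gker_toT_eq_torusKernel`: the torus kernel IS
`torusKernel (descendC G_a) P_n (x′ − x)`; then `tendsto_torusKernel_descend` with `B5Hk163Decay.stripRegular_G163`).
[cite: Balaban1984PropagatorsI, (1.63) p.28, p.36; Balaban1987RG1, (1.21) p.264] [folklore] -/
theorem tendsto_hker_bpt (nm : ℕ) [NeZero nm] (μ lam : Fin (d + 1)) (a : Fin (d + 1) → Fin nm)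
    {P : ℕ → Fin (d + 1) → ℕ} [∀ n i, NeZero (P n i)] (hP : ∀ i, Tendsto (fun n => P n i) atTop atTop)
    (x' x : Fin (d + 1) → ℤ) :
    Tendsto (fun n => hker nm (P n) μ lam (bpt nm (P n) (toT (P n) x') a) (toT (P n) x)) atTop
      (𝓝 (latticeKernel (fun p : Fin (d + 1) → ℂ => G163 nm μ lam a p) (x' - x))) := by
  have hP1 : ∀ n i, 1 ≤ P n i := fun n i => Nat.one_le_iff_ne_zero.mpr (NeZero.ne _)
  refine (tendsto_torusKernel_descend (stripRegular_G163 nm (kappa163_pos _).le le_rfl μ lam a)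
    (kappa163_pos _) hP1 hP (x' - x)).congr fun n => ?_
  rw [hker_bpt, toT_sub, gker_toT_eq_torusKernel]

/-- The same on the cubic tori of the leaf lists: `P_n = (N n·M, …, N n·M)` with `N n → ∞` cubes of side `M ≥ 1` per
direction. [cite: Balaban1987RG1, (1.21) p.264, (5.10) p.293] [folklore] -/
theorem tendsto_hker_bpt_cubes (nm : ℕ) [NeZero nm] (μ lam : Fin (d + 1)) (a : Fin (d + 1) → Fin nm)
    {N : ℕ → ℕ} [∀ n, NeZero (N n)] {Mc : ℕ} [NeZero Mc] (hN : Tendsto N atTop atTop)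
    (x' x : Fin (d + 1) → ℤ) :
    Tendsto (fun n => hker nm (fun _ : Fin (d + 1) => N n * Mc) μ lam
        (bpt nm (fun _ : Fin (d + 1) => N n * Mc) (toT (fun _ : Fin (d + 1) => N n * Mc) x') a)
        (toT (fun _ : Fin (d + 1) => N n * Mc) x)) atTop
      (𝓝 (latticeKernel (fun p : Fin (d + 1) → ℂ => G163 nm μ lam a p) (x' - x))) :=
  tendsto_hker_bpt nm μ lam a (P := fun n (_ : Fin (d + 1)) => N n * Mc)
    (fun _ => tendsto_atTop_mono (fun n => Nat.le_mul_of_pos_right (N n) (Nat.pos_of_neZero Mc)) hN) x' x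

end Kernels

/-! ## 3. NODE E's field `hconv` on the two-grid carrier, for the socket inhabited by `H_k` -/

section NodeE

variable {Mc : ℕ} [NeZero Mc] {N : ℕ → ℕ} [∀ n, NeZero (N n)] {q : Consts190}

/-- **[I] (1.21) FOR THE FLAT `H_k` ON THE TWO-GRID CARRIER.**  Let `𝒟` be a (190)-socket over the fine 1-forms
`Wn n := T_η(n) × Fin D → ℂ` (`T_η(n)` the torus with `nm·N n·M` fine sites per direction, `D = d + 1`) whose (4.35) test
vector at the source site `y` is the column of `H_k = HkOp nm (N n·M, …)` at the unit source 1-form `δ_{(y,μ₀)}`,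
restricted to the fine bonds over the cubes of `X̄` (`hrule` — the computation rule of
`RemainderDecay190TwoGridHk.exists_data190_twoGrid_HkOp`, generation 101).  Fix, for every ℤ^{d+1} localization domain
`Y`, finitely many FINE LATTICE BONDS `(nm·x′_i + a_i, μ_i)` of `(1∕nm)ℤ^{d+1}` — coarse lattice point `x′_i = ex Y i`,
fine offset `a_i = ea Y i`, direction `μ_i = eμ Y i` — with `x′_i` inside the cubes of `Y` (`he`), and let `N n → ∞`.
Then the window read-out of the test vectors converges:
`(𝒟.hn n (tproj Y) [x] (nm·[x′_i] + a_i, μ_i))_i → (latticeKernel (G163 nm μ_i μ₀ a_i) (x′_i − x))_i` — the field `hconv`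
of `PolLeavesTFac190` with `V Y := ι Y → ℂ`, `r n Y :=` the product of the coordinate projections at the window bonds
(the continuous linear map displayed), `t Y x :=` the window column of the infinite-lattice kernel of `H_k` at the
source bond `(x, μ₀)`.  (Inside the cubes of `Y` the indicator of `hrule` is `1`: `blockOf (nm·ȳ′ + a) = ȳ′`
(`B5Blocks16.blockOf_bpt`) and `tcubeOf_proj_mem_tproj`; the entries converge by `tendsto_hker_bpt_cubes`.)
[cite: Balaban1987RG1, (1.21) p.264, (4.35) p.290, (5.10) p.293; Balaban1984PropagatorsI, (1.63) p.28, p.36] [folklore] -/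
theorem hconv_twoGrid_HkOp_of_rule (nm : ℕ) [NeZero nm] (μ₀ : Fin (d + 1))
    (D : Data190 (d + 1) Mc N (fun n => Tor (fine nm (fun _ : Fin (d + 1) => N n * Mc)) × Fin (d + 1) → ℂ) q)
    (hrule : ∀ (n : ℕ) (X : TDom (d + 1) (N n)) (y : TPt (d + 1) (N n * Mc)),
      D.hn n X y = fun p : Tor (fine nm (fun _ : Fin (d + 1) => N n * Mc)) × Fin (d + 1) =>
        if tcubeOf (N n) Mc (B5Blocks16.blockOf nm (fun _ : Fin (d + 1) => N n * Mc) p.1) ∈ X.1 then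
          (HkOp nm (fun _ : Fin (d + 1) => N n * Mc) *ᵥ (Pi.single (y, μ₀) (1 : ℂ))) p
        else 0)
    (hN : Tendsto N atTop atTop) {ι : LDom (d + 1) → Type} [∀ Y, Fintype (ι Y)]
    (ex : (Y : LDom (d + 1)) → ι Y → Pt (d + 1)) (ea : (Y : LDom (d + 1)) → ι Y → (Fin (d + 1) → Fin nm))
    (eμ : (Y : LDom (d + 1)) → ι Y → Fin (d + 1)) (he : ∀ Y i, cubeOf Mc (ex Y i) ∈ Y.1) :
    ∀ (Y : LDom (d + 1)) (x : Pt (d + 1)),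
      Tendsto (fun n =>
        (ContinuousLinearMap.pi fun i : ι Y =>
            ContinuousLinearMap.proj (R := ℂ)
              (φ := fun _ : Tor (fine nm (fun _ : Fin (d + 1) => N n * Mc)) × Fin (d + 1) => ℂ)
              (bpt nm (fun _ : Fin (d + 1) => N n * Mc) (proj (N n * Mc) (ex Y i)) (ea Y i), eμ Y i))
          (D.hn n (tproj (N n) Y) (proj (N n * Mc) x))) atTop
        (𝓝 fun i => latticeKernel (fun p : Fin (d + 1) → ℂ => G163 nm (eμ Y i) μ₀ (ea Y i) p) (ex Y i - x)) := by
  intro Y x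
  refine tendsto_pi_nhds.2 fun i => ?_
  refine (tendsto_hker_bpt_cubes nm (eμ Y i) μ₀ (ea Y i) (Mc := Mc) hN (ex Y i) x).congr fun n => ?_
  rw [ContinuousLinearMap.pi_apply, ContinuousLinearMap.proj_apply, hrule]
  dsimp only
  rw [B5Blocks16.blockOf_bpt, if_pos (tcubeOf_proj_mem_tproj Y (he Y i)), Matrix.mulVec_single_one]
  rfl

/-- The same read as plain functions on the window (no continuous-linear-map packaging): for every window bond,
`𝒟.hn n (tproj Y) [x] (nm·[x′_i] + a_i, μ_i) → latticeKernel (G163 nm μ_i μ₀ a_i) (x′_i − x)`.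
[cite: Balaban1987RG1, (1.21) p.264, (4.35) p.290; Balaban1984PropagatorsI, (1.63) p.28, p.36] [folklore] -/
theorem tendsto_hn_twoGrid_HkOp_of_rule (nm : ℕ) [NeZero nm] (μ₀ : Fin (d + 1))
    (D : Data190 (d + 1) Mc N (fun n => Tor (fine nm (fun _ : Fin (d + 1) => N n * Mc)) × Fin (d + 1) → ℂ) q)
    (hrule : ∀ (n : ℕ) (X : TDom (d + 1) (N n)) (y : TPt (d + 1) (N n * Mc)),
      D.hn n X y = fun p : Tor (fine nm (fun _ : Fin (d + 1) => N n * Mc)) × Fin (d + 1) =>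
        if tcubeOf (N n) Mc (B5Blocks16.blockOf nm (fun _ : Fin (d + 1) => N n * Mc) p.1) ∈ X.1 then
          (HkOp nm (fun _ : Fin (d + 1) => N n * Mc) *ᵥ (Pi.single (y, μ₀) (1 : ℂ))) p
        else 0)
    (hN : Tendsto N atTop atTop) (Y : LDom (d + 1)) {x' : Pt (d + 1)} (hx' : cubeOf Mc x' ∈ Y.1)
    (a : Fin (d + 1) → Fin nm) (μ : Fin (d + 1)) (x : Pt (d + 1)) :
    Tendsto (fun n => D.hn n (tproj (N n) Y) (proj (N n * Mc) x)
        (bpt nm (fun _ : Fin (d + 1) => N n * Mc) (proj (N n * Mc) x') a, μ)) atTop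
      (𝓝 (latticeKernel (fun p : Fin (d + 1) → ℂ => G163 nm μ μ₀ a p) (x' - x))) := by
  refine (tendsto_hker_bpt_cubes nm μ μ₀ a (Mc := Mc) hN x' x).congr fun n => ?_
  rw [hrule]
  dsimp only
  rw [B5Blocks16.blockOf_bpt, if_pos (tcubeOf_proj_mem_tproj Y hx'), Matrix.mulVec_single_one]
  rfl

end NodeE

end

end Literature.MathematicalPhysics.QuantumFieldTheory.Balaban1983to89.Beta.RemainderDecay190TwoGridHkLimit
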